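import Mathlib.Data.Fintype.Vector
import Mathlib.LinearAlgebra.Basis.VectorSpace
import Mathlib.LinearAlgebra.Matrix.Nondegenerate
import Literature.LinearAlgebra.Matrix.RankMinors
import Literature.Computability.AlgebraicComplexity.OrbitClosure
import Literature.Barriers.ValiantsHypothesis.ShiftedPartialsMonotone
import HarnessLib

/-!
# Shifted partial derivatives: ranks do not increase on orbit CLOSURES
(Efremenko–Landsberg–Schenck–Weyman 2018, §1.1 with Rem. 1.3) — discharge of
`shiftedPartialsRank_le_of_mem_orbitClosure`

`ShiftedPartialDerivatives.lean` records as a named fact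
(`Literature.Barriers.ValiantsHypothesis.shiftedPartialsRank_le_of_mem_orbitClosure : Prop`) the
soundness of the method of shifted partial derivatives for orbit closures: ELSW §1.1 (checked with
`lit read`, arXiv:1609.02103 p. 3) "Again `P ∈ End(W)·Q` implies that
`rank(P_{(k,n-k)[τ]}) ≤ rank(Q_{(k,n-k)[τ]})`", together with Rem. 1.3 "Both these methods are
algebraic in the sense that they actually prove `P ∉ \overline{End(W)·Q}` where the overline
denotes Zariski closure." The source prints no proof (the statement is the standard lower
semicontinuity of matrix rank); this file proves it:

* `shiftedPartialsRank_le_of_mem_orbitClosure_holds : shiftedPartialsRank_le_of_mem_orbitClosure`.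

(A sibling of `ShiftedPartialsMonotone.lean`, which proves the orbit step and defers exactly this
closure step; `ShiftedPartialDerivativesProofs.lean` is the discharge of Thm. 1.5 up to Macaulay's
theorem and imports the four case files, which this file does not need.)

In fact more is proved (`shiftedPartialsRank_le_of_mem_orbitClosure_field`): over EVERY field `K`,
for polynomials `f, g` of any degree in finitely many variables and all `k, τ`,
`g ∈ orbitClosure f` (the tree's `Δ[f] = \overline{GL · f}`, `OrbitClosure.lean`) implies
`shiftedPartialsRank K k τ g ≤ shiftedPartialsRank K k τ f`; the printed hypotheses
"`P, Q ∈ S^nW`, `k < n`" carried by the fact are not used.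

## Proof

* The orbit step is the tree's `shiftedPartialsRank_linSubst_le` (`ShiftedPartialsMonotone.lean`):
  `rank(A·f) ≤ rank(f)` for every square matrix `A`, in particular on `GL · f`.
* Closure step (`finrank_span_le_of_mem_orbitClosure`, stated for any finite family `Φ p` of
  polynomials attached to `p` whose coefficients are polynomials in the coefficient vector
  `coeffVec p`): "`dim span (Φ p) ≥ r + 1`" holds iff some `r + 1` members of the family have a
  non-vanishing `(r+1) × (r+1)` minor of coefficients (`linearIndependent_of_det_coeff_ne_zero`,
  `exists_det_coeff_ne_zero_of_linearIndependent` — via the tree's rank-by-minors file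
  `Literature/LinearAlgebra/Matrix/RankMinors.lean` — and
  `le_finrank_span_of_linearIndependent_comp`, `exists_linearIndependent_comp_of_le_finrank_span`);
  such a minor is `aeval (coeffVec p) Q` for a polynomial `Q` in the coordinates of the coefficient
  space (`AlgHom.map_det`), it vanishes on `GL · f` when the rank is `≤ r` there, hence at every
  point of the Zariski closure (`mem_orbitClosure_iff`).
* The shifted flattening fits: `coeff d (x^β · ∂_l p) = c · coeff e p` for constants `c, e`
  depending only on `(l, β, d)` (`exists_coeff_iterPDeriv_eq`,
  `exists_coeff_monomial_mul_iterPDeriv_eq`, from Mathlib's `coeff_pderiv`, `coeff_monomial_mul'`),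
  and the shifted partials of order `k`, shift `τ` are the family indexed by
  `List.Vector σ k × univ.finsuppAntidiag τ` (`shiftedPartials_eq_range`).

## References

* [EfremenkoLandsbergSchenckWeyman2018] K. Efremenko, J. M. Landsberg, H. Schenck, J. Weyman,
  *The method of shifted partial derivatives cannot separate the permanent from the
  determinant*, Math. Comp. 87 (2018) 2037–2045, §1.1 and Rem. 1.3.

## Mathlib and tree

Mathlib: `exists_linearIndependent'`, `finrank_span_eq_card`,
`LinearIndependent.fintype_card_le_finrank`, `LinearIndependent.rank_matrix`,
`Matrix.eq_zero_of_vecMul_eq_zero`, `AlgHom.map_det`, `MvPolynomial.coeff_pderiv`,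
`MvPolynomial.coeff_monomial_mul'`. Tree: `orbitClosure`, `mem_orbitClosure_iff`, `coeffVec`,
`glOrbit`, `linSubstRep_apply` (`OrbitClosure.lean`, `LinSubst.lean`);
`shiftedPartialsRank_linSubst_le`, `degree_eq_iff_mem_finsuppAntidiag`
(`ShiftedPartialsMonotone.lean`); `exists_det_submatrix_ne_zero_of_le_rank` (`RankMinors.lean`).
Theorems only, no definitions.
-/

noncomputable section

namespace Literature.Barriers.ValiantsHypothesis

open Literature.Computability.AlgebraicComplexity MvPolynomial
open scoped Matrix

/-! ### Linear algebra: independent subfamilies and the dimension of a span -/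

section LinAlg

variable {K : Type*} [DivisionRing K] {M : Type*} [AddCommGroup M] [Module K M] {ι : Type*}

/-- If `s` members `v (a 0), …, v (a (s-1))` of a finite family are linearly independent then
`s ≤ dim span (range v)`. [folklore] -/
theorem le_finrank_span_of_linearIndependent_comp [Finite ι] (v : ι → M) {s : ℕ}
    (a : Fin s → ι) (h : LinearIndependent K (v ∘ a)) :
    s ≤ Module.finrank K (Submodule.span K (Set.range v)) := by
  haveI : Module.Finite K (Submodule.span K (Set.range v)) :=
    Module.Finite.span_of_finite K (Set.finite_range v)
  let w : Fin s → Submodule.span K (Set.range v) :=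
    fun i => ⟨v (a i), Submodule.subset_span ⟨a i, rfl⟩⟩
  have hw : LinearIndependent K w :=
    LinearIndependent.of_comp (Submodule.span K (Set.range v)).subtype h
  simpa using hw.fintype_card_le_finrank

/-- If `s ≤ dim span (range v)` for a finite family `v` then some `s` members of the family, with
distinct indices, are linearly independent. [folklore] -/
theorem exists_linearIndependent_comp_of_le_finrank_span [Fintype ι] (v : ι → M) {s : ℕ}
    (hs : s ≤ Module.finrank K (Submodule.span K (Set.range v))) :
    ∃ a : Fin s → ι, Function.Injective a ∧ LinearIndependent K (v ∘ a) := by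
  classical
  obtain ⟨κ, a, ha, hspan, hli⟩ := exists_linearIndependent' (K := K) v
  haveI : Fintype κ := Fintype.ofInjective a ha
  have hcard : s ≤ Fintype.card κ := by
    have h1 : Module.finrank K (Submodule.span K (Set.range (v ∘ a))) = Fintype.card κ :=
      finrank_span_eq_card hli
    rw [hspan] at h1
    omega
  let e : Fin s ↪ κ := (Fin.castLEEmb hcard).trans (Fintype.equivFin κ).symm.toEmbedding
  exact ⟨a ∘ e, ha.comp e.injective, hli.comp e e.injective⟩

end LinAlg

/-! ### Coefficient minors of families of polynomials -/

section CoeffMinors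

variable {K : Type*} [Field K] {σ : Type*}

/-- A non-vanishing `s × s` minor `det (coeff (c j) (w i))_{i,j}` of coefficients makes the
polynomials `w 0, …, w (s-1)` linearly independent. [folklore] -/
theorem linearIndependent_of_det_coeff_ne_zero {s : ℕ} (w : Fin s → MvPolynomial σ K)
    (c : Fin s → (σ →₀ ℕ)) (h : (Matrix.of fun i j => coeff (c j) (w i)).det ≠ 0) :
    LinearIndependent K w := by
  rw [Fintype.linearIndependent_iff]
  intro g hg i
  have hvec : g ᵥ* (Matrix.of fun i j => coeff (c j) (w i)) = 0 := by
    funext j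
    have := congrArg (coeff (c j)) hg
    simpa [Matrix.vecMul, dotProduct, coeff_sum] using this
  exact congrFun (Matrix.eq_zero_of_vecMul_eq_zero h hvec) i

/-- Conversely, `s` linearly independent polynomials have a non-vanishing `s × s` minor of
coefficients (rows possibly re-selected): restrict the coefficient vectors to the finite union of
the supports and use rank = row rank = size of a largest non-zero minor. [folklore] -/
theorem exists_det_coeff_ne_zero_of_linearIndependent {s : ℕ} {w : Fin s → MvPolynomial σ K}
    (hw : LinearIndependent K w) :
    ∃ (r : Fin s → Fin s) (c : Fin s → (σ →₀ ℕ)),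
      (Matrix.of fun i j => coeff (c j) (w (r i))).det ≠ 0 := by
  classical
  set T : Finset (σ →₀ ℕ) := Finset.univ.biUnion fun i => (w i).support with hT
  set N : Matrix (Fin s) T K := Matrix.of fun i t => coeff (t : σ →₀ ℕ) (w i) with hN
  have hrows : LinearIndependent K N.row := by
    rw [Fintype.linearIndependent_iff]
    intro g hg
    have hsum : ∑ i, g i • w i = 0 := by
      ext d
      rw [coeff_sum, coeff_zero]
      simp only [coeff_smul, smul_eq_mul]
      by_cases hd : d ∈ T
      · have := congrFun hg ⟨d, hd⟩
        simpa [hN, Matrix.row_def] using this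
      · refine Finset.sum_eq_zero fun i _ => ?_
        have h0 : coeff d (w i) = 0 := by
          rw [← notMem_support_iff]
          intro hmem
          exact hd (Finset.mem_biUnion.2 ⟨i, Finset.mem_univ _, hmem⟩)
        rw [h0, mul_zero]
    exact (Fintype.linearIndependent_iff.1 hw) g hsum
  have hrank : N.rank = s := by simpa using hrows.rank_matrix
  obtain ⟨r, c, -, -, hdet⟩ :=
    Literature.LinearAlgebra.Matrix.exists_det_submatrix_ne_zero_of_le_rank N hrank.ge
  refine ⟨r, fun j => (c j : σ →₀ ℕ), ?_⟩
  have hsub : N.submatrix r c = Matrix.of fun i j => coeff ((c j : σ →₀ ℕ)) (w (r i)) := by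
    ext i j; rfl
  rw [hsub] at hdet
  exact hdet

end CoeffMinors

/-! ### Coefficients of shifted partials are fixed multiples of single coefficients -/

section Coeffs

variable {R : Type*} [CommSemiring R] {σ : Type*}

/-- For every derivative list `l` and exponent `d` there are a constant `c` and an exponent `e`
with `coeff d (∂_l p) = c · coeff e p` for ALL `p` (iterate Mathlib's `coeff_pderiv`). [folklore] -/
theorem exists_coeff_iterPDeriv_eq (l : List σ) (d : σ →₀ ℕ) :
    ∃ (c : R) (e : σ →₀ ℕ), ∀ p : MvPolynomial σ R, coeff d (iterPDeriv l p) = c * coeff e p := by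
  induction l generalizing d with
  | nil => exact ⟨1, d, fun p => by simp⟩
  | cons i l ih =>
    obtain ⟨c, e, hce⟩ := ih (d + Finsupp.single i 1)
    refine ⟨((d i : R) + 1) * c, e, fun p => ?_⟩
    rw [iterPDeriv_cons, coeff_pderiv, hce]
    ring

/-- The same for the shifted partials `x^β · ∂_l p`: `coeff d (x^β ∂_l p) = c · coeff e p` for a
constant `c` and an exponent `e` depending only on `(l, β, d)`. [folklore] -/
theorem exists_coeff_monomial_mul_iterPDeriv_eq (l : List σ) (β d : σ →₀ ℕ) :
    ∃ (c : R) (e : σ →₀ ℕ), ∀ p : MvPolynomial σ R,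
      coeff d (monomial β (1 : R) * iterPDeriv l p) = c * coeff e p := by
  classical
  by_cases h : β ≤ d
  · obtain ⟨c, e, hce⟩ := exists_coeff_iterPDeriv_eq (R := R) l (d - β)
    exact ⟨c, e, fun p => by rw [coeff_monomial_mul', if_pos h, one_mul, hce]⟩
  · exact ⟨0, 0, fun p => by rw [coeff_monomial_mul', if_neg h, zero_mul]⟩

end Coeffs

/-! ### Semicontinuity on orbit closures -/

section Semicontinuity

variable {K : Type*} [Field K] {σ : Type*} [Fintype σ] [DecidableEq σ]

/-- **Lower semicontinuity of flattening ranks on orbit closures** (the content of ELSW Rem. 1.3: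
rank methods "actually prove `P ∉ \overline{End(W)·Q}` where the overline denotes Zariski
closure"). Let every polynomial `p` carry a finite family `Φ p : ι → K[x]` whose coefficients are
polynomials in the coefficient vector of `p` (`coeff d (Φ p i) = (P i d)(coeffVec p)`). If
`dim span (Φ h) ≤ r` for all `h` in the orbit `GL · f`, then `dim span (Φ g) ≤ r` for every `g` in
the orbit closure `Δ[f]`: "`dim span ≥ r + 1`" is witnessed by a non-zero `(r+1) × (r+1)` minor of
coefficients, a polynomial in `coeffVec` that vanishes on the orbit and hence on its Zariski
closure. [cite: EfremenkoLandsbergSchenckWeyman2018, Rem. 1.3] -/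
theorem finrank_span_le_of_mem_orbitClosure {ι : Type*} [Fintype ι]
    (Φ : MvPolynomial σ K → ι → MvPolynomial σ K) (P : ι → (σ →₀ ℕ) → MvPolynomial (σ →₀ ℕ) K)
    (hΦ : ∀ p i d, coeff d (Φ p i) = aeval (coeffVec p) (P i d))
    {f g : MvPolynomial σ K} (hg : g ∈ orbitClosure f) {r : ℕ}
    (hr : ∀ h ∈ glOrbit σ K f, Module.finrank K (Submodule.span K (Set.range (Φ h))) ≤ r) :
    Module.finrank K (Submodule.span K (Set.range (Φ g))) ≤ r := by
  classical
  by_contra hlt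
  -- `r + 1` independent members of `Φ g` and a non-vanishing `(r+1)`-minor of their coefficients
  obtain ⟨a, -, hli⟩ := exists_linearIndependent_comp_of_le_finrank_span (Φ g)
    (Nat.succ_le_of_lt (not_le.1 hlt))
  obtain ⟨ρ, cc, hdet⟩ := exists_det_coeff_ne_zero_of_linearIndependent hli
  -- that minor is a polynomial `Q` in the coefficient vector
  set Q : MvPolynomial (σ →₀ ℕ) K := (Matrix.of fun i j => P (a (ρ i)) (cc j)).det with hQ
  have hQeval : ∀ p : MvPolynomial σ K, aeval (coeffVec p) Q =
      (Matrix.of fun i j => coeff (cc j) (Φ p (a (ρ i)))).det := by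
    intro p
    rw [hQ, AlgHom.map_det, AlgHom.mapMatrix_apply]
    congr 1
    ext i j
    simp [hΦ]
  -- `Q` vanishes on the orbit (rank `≤ r` there), hence at `g`
  have hvan : aeval (coeffVec g) Q = 0 := by
    refine (mem_orbitClosure_iff.1 hg) Q fun h hh => ?_
    rw [hQeval]
    by_contra hne
    have hli' := linearIndependent_of_det_coeff_ne_zero (fun i => Φ h (a (ρ i))) cc hne
    have hle := le_finrank_span_of_linearIndependent_comp (Φ h) (a ∘ ρ) hli'
    have := hr h hh
    omega
  rw [hQeval] at hvan
  exact hdet hvan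

/-- The shifted partials of order `k` and shift `τ` of `p` are the family
`(l, β) ↦ x^β · ∂_l p` indexed by the finite type `List.Vector σ k × univ.finsuppAntidiag τ`
(derivative lists of length `k`, exponents of degree `τ`). [folklore] -/
theorem shiftedPartials_eq_range (k τ : ℕ) (p : MvPolynomial σ K) :
    shiftedPartials k τ p = Set.range
      (fun i : List.Vector σ k × ↥((Finset.univ : Finset σ).finsuppAntidiag τ) =>
        monomial (i.2 : σ →₀ ℕ) (1 : K) * iterPDeriv i.1.1 p) := by
  ext h
  constructor
  · rintro ⟨l, β, hl, hβ, rfl⟩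
    exact ⟨(⟨l, hl⟩, ⟨β, (degree_eq_iff_mem_finsuppAntidiag β τ).1 hβ⟩), rfl⟩
  · rintro ⟨⟨l, β⟩, rfl⟩
    exact ⟨l.1, β.1, l.2, (degree_eq_iff_mem_finsuppAntidiag _ τ).2 β.2, rfl⟩

/-- `shiftedPartialsRank` as the dimension of the span of that indexed family. [folklore] -/
theorem shiftedPartialsRank_eq_finrank_span_range (k τ : ℕ) (p : MvPolynomial σ K) :
    shiftedPartialsRank K k τ p = Module.finrank K (Submodule.span K (Set.range
      (fun i : List.Vector σ k × ↥((Finset.univ : Finset σ).finsuppAntidiag τ) =>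
        monomial (i.2 : σ →₀ ℕ) (1 : K) * iterPDeriv i.1.1 p))) := by
  rw [shiftedPartialsRank, shiftedPartials_eq_range]

/-- **Soundness of the method of shifted partial derivatives for orbit closures, over any field and
in any degree**: if `g ∈ Δ[f] = \overline{GL · f}` then
`rank(g_{(k,·)[τ]}) ≤ rank(f_{(k,·)[τ]})` for all `k, τ` (ELSW §1.1 with Rem. 1.3; on the orbit
this is the tree's `shiftedPartialsRank_linSubst_le`, and the inequality persists on the Zariski
closure by `finrank_span_le_of_mem_orbitClosure`). [cite: EfremenkoLandsbergSchenckWeyman2018, §1.1 and Rem. 1.3] -/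
theorem shiftedPartialsRank_le_of_mem_orbitClosure_field {f g : MvPolynomial σ K}
    (hg : g ∈ orbitClosure f) (k τ : ℕ) :
    shiftedPartialsRank K k τ g ≤ shiftedPartialsRank K k τ f := by
  classical
  have hex : ∀ (i : List.Vector σ k × ↥((Finset.univ : Finset σ).finsuppAntidiag τ))
      (d : σ →₀ ℕ), ∃ (c : K) (e : σ →₀ ℕ), ∀ p : MvPolynomial σ K,
        coeff d (monomial (i.2 : σ →₀ ℕ) (1 : K) * iterPDeriv i.1.1 p) = c * coeff e p :=
    fun i d => exists_coeff_monomial_mul_iterPDeriv_eq i.1.1 i.2 d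
  choose c e hce using hex
  rw [shiftedPartialsRank_eq_finrank_span_range, shiftedPartialsRank_eq_finrank_span_range]
  refine finrank_span_le_of_mem_orbitClosure
    (fun (p : MvPolynomial σ K) (i : List.Vector σ k × ↥((Finset.univ : Finset σ).finsuppAntidiag τ)) =>
      monomial (i.2 : σ →₀ ℕ) (1 : K) * iterPDeriv i.1.1 p)
    (fun i d => C (c i d) * X (e i d)) (fun p i d => by simp [hce]) hg ?_
  rintro h ⟨A, rfl⟩
  have := shiftedPartialsRank_linSubst_le (A : Matrix σ σ K) k τ f
  rwa [shiftedPartialsRank_eq_finrank_span_range, shiftedPartialsRank_eq_finrank_span_range] at this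

end Semicontinuity

/-! ### Discharge of the named fact -/

/-- **Discharge of `shiftedPartialsRank_le_of_mem_orbitClosure`** (ELSW §1.1 with Rem. 1.3, in the
tree's terms: forms `f, g` of degree `n` over `ℂ`, `g ∈ orbitClosure f`, `k < n` ⟹
`shiftedPartialsRank ℂ k τ g ≤ shiftedPartialsRank ℂ k τ f`), a special case of
`shiftedPartialsRank_le_of_mem_orbitClosure_field`. [cite: EfremenkoLandsbergSchenckWeyman2018, §1.1 and Rem. 1.3] -/
theorem shiftedPartialsRank_le_of_mem_orbitClosure_holds :
    shiftedPartialsRank_le_of_mem_orbitClosure := by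
  intro σ _ _ n f g _ _ hg k τ _
  exact shiftedPartialsRank_le_of_mem_orbitClosure_field hg k τ

end Literature.Barriers.ValiantsHypothesis
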